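import Mathlib.Algebra.MvPolynomial.Basic
import Mathlib.RingTheory.MvPolynomial.Basic
import HarnessLib

/-!
# Nonzero multiples of a multilinear polynomial are at least as sparse as it (Oliveira; FSTW, Prop. 74)

M. A. Forbes, A. Shpilka, I. Tzameret, A. Wigderson, *Proof complexity lower bounds from
algebraic circuit complexity*, Theory of Computing 17 (2021) (= arXiv:1606.05050, read for this
file), §7, **Proposition 74** (attributed to Oliveira [Oliveira15b]):

> "Let `f(x) ∈ 𝔽[x_1, …, x_n]` be a nonzero multilinear polynomial with sparsity exactly `s`.
> Then any nonzero multiple of `f` has sparsity `≥ s`."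

with the remark after the proof: "nonzero multiples of the determinant or permanent are `n!`
sparse, which is tight" — the consumer's instance (route
`Summits/ValiantsHypothesis/ValiantsHypothesis/Theses/PlantedHittingSets`, item `SparseMultiples`:
`m! ≤ #supp(g · per_m)`, from this fact and the support of `perPoly` = the `m!` permutation
monomials, tree: `coeff_perPoly`, `permMonomial_injective`, `degreeOf_perPoly` in
`PermanentIrreducible.lean`). Proof in print: induction on `n`, splitting off one variable
(multilinearity is essential: `x^n − 1` is a 2-sparse multiple of `x^{n-1} + ⋯ + 1`).

Rendering: `𝔽` any field (the paper's ambient field is arbitrary; the proof uses only that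
`𝔽[x]` is a domain); variables `Fin n`; "sparsity" = `f.support.card`; "multilinear" = every
exponent vector in the support is `≤ 1` coordinatewise; "multiple" = `g * f` with `g ≠ 0`.

## References

* [ForbesShpilkaTzameretWigderson2021] Thm/Prop numbering of arXiv:1606.05050: §7 Prop. 74 and
  the remark following its proof; [Oliveira15b] = R. Oliveira, *Factors of low individual degree
  polynomials*, CCC 2015 (as cited there).
-/

namespace Literature.Computability.AlgebraicComplexity

open MvPolynomial

/-- **FSTW (ToC 2021 / arXiv:1606.05050) Prop. 74, after Oliveira 2015: sparsity of multiples of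
a multilinear polynomial.** "Let `f ∈ 𝔽[x_1,…,x_n]` be a nonzero multilinear polynomial with
sparsity exactly `s`. Then any nonzero multiple of `f` has sparsity `≥ s`." Rendered: for a field
`F`, `f g : MvPolynomial (Fin n) F`, `f ≠ 0` multilinear (`∀ d ∈ f.support, ∀ i, d i ≤ 1`) and
`g ≠ 0`: `f.support.card ≤ (g * f).support.card`. Grounds
`Summit.ValiantsHypothesis.ValiantsHypothesis.Theses.PlantedHittingSets.SparseMultiples`
(with the `m!` permutation monomials of `perPoly`).
[cite: ForbesShpilkaTzameretWigderson2021, Prop. 74] -/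
def FSTW2016_sparsity_of_multiples : Prop :=
  ∀ (F : Type) [Field F] (n : ℕ) (f g : MvPolynomial (Fin n) F),
    f ≠ 0 → (∀ d ∈ f.support, ∀ i, d i ≤ 1) → g ≠ 0 →
      f.support.card ≤ (g * f).support.card

end Literature.Computability.AlgebraicComplexity
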